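import Summits.Ventures.Crystal3D.Theorems.StickyWulffConstantNoReconstructionGainCapFrameLocal
import HarnessLib

/-!
# The gain identity in an arbitrary registration frame, for an arbitrary substrate (closure form)

HONEST FRAMING. Part of the venture `Summits/Ventures/Crystal3D` (cell `crystal3d-full`), helper
`--supports` the crux `NoReconstructionGain` (stmt-Ventures-19144, route
`route-Ventures-StickyWulffConstant`), line `adhesion` (wulff-p1 g10); the global half of
`…CapFrameLocal`.  No hypothesis on the substrate `P` (any finite subset of the packing), none on the
position of the film, none on `ν`; the frame `U` is any finite set of unit vectors closed under
negation with pairwise `⟪d,d'⟫ ≤ 2c² − 1`, cap threshold `c ≥ √3/2`: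

* `frameGain_eq` — **exact identity**
  `#cross(P, X∖P) = D(X∖P) + Σ_{q ∈ X∖P} [a(q) − v(q)] + ((|U| − 12)/2)·#(X∖P) + Σ_{q ∈ X∖P} r(q)`,
  `a(q)` = interstitial substrate contacts + interstitial film contacts `ν`-below + ½ `ν`-level,
  `v(q)` = vacant caps `d` with `⟪d,ν⟫ < 0` + ½ vacant caps with `⟪d,ν⟫ = 0`,
  `r(q)` = substrate contacts of `q` in a cap `d` with `⟪d,ν⟫ > 0` + ½ those with `⟪d,ν⟫ = 0`
  (the RIM term: for the fcc slab sample with the film above the cut it is supported on the lateral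
  rim, `…InterstitialGain`; for other substrates it is what the user must bound).

With the fcc star (`|U| = 12`, `c = √3/2`) this is the identity behind `interstitialGain_slab` /
`interstitialGain_lower`; with the 18-direction Barlow bilayer star (`c = cos 16.78°`) every bond of
every Barlow stacking on that basal plane is registered and each film ball carries the constant
`(18 − 12)/2 = 3` against its three extra vacant out-of-registry caps — the frame in which one-plate
adhesion on BARLOW substrates (T line) is a rim lemma away from the fcc case.

WHAT THIS IS NOT: a bound — it is an identity; the rim term and the cap balance are the content;
rung F-C1 not moved.
-/

noncomputable section

namespace Summit.Ventures.Crystal3D.Theorems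

open Summit.Ventures.Crystal3D Finset
open Literature.MathematicalPhysics.StatisticalMechanics (orderedContacts contactDeficiency)
open scoped InnerProductSpace

/-- **The gain identity in a frame** (see the module docstring). -/
theorem frameGain_eq (X P : Finset (EuclideanSpace ℝ (Fin 3)))
    (hX : ∀ p ∈ X, ∀ q ∈ X, p ≠ q → 1 ≤ dist p q) (hPX : P ⊆ X)
    (U : Finset (EuclideanSpace ℝ (Fin 3))) (c : ℝ) (hc3 : Real.sqrt 3 / 2 ≤ c)
    (hU1 : ∀ d ∈ U, ‖d‖ = 1) (hUsep : ∀ d ∈ U, ∀ d' ∈ U, d ≠ d' → ⟪d, d'⟫_ℝ ≤ 2 * c ^ 2 - 1)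
    (hUneg : ∀ d ∈ U, -d ∈ U) (ν : EuclideanSpace ℝ (Fin 3)) :
    ((((P ×ˢ (X \ P)).filter fun pq => dist pq.1 pq.2 = 1).card : ℕ) : ℝ) =
      contactDeficiency (X \ P)
        + ∑ q ∈ X \ P,
          (((P.filter fun p => dist q p = 1 ∧ ∀ d ∈ U, ⟪p - q, d⟫_ℝ ≤ c).card : ℝ)
            + (((X \ P).filter fun x => dist q x = 1 ∧ (∀ d ∈ U, ⟪x - q, d⟫_ℝ ≤ c) ∧
                ⟪x, ν⟫_ℝ < ⟪q, ν⟫_ℝ).card : ℝ)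
            + (1 / 2) * (((X \ P).filter fun x => dist q x = 1 ∧ (∀ d ∈ U, ⟪x - q, d⟫_ℝ ≤ c) ∧
                ⟪x, ν⟫_ℝ = ⟪q, ν⟫_ℝ).card : ℝ)
            - ((U.filter fun d => ⟪d, ν⟫_ℝ < 0 ∧ ∀ x ∈ X, dist q x = 1 → ⟪x - q, d⟫_ℝ ≤ c).card : ℝ)
            - (1 / 2) * ((U.filter fun d => ⟪d, ν⟫_ℝ = 0 ∧ ∀ x ∈ X, dist q x = 1 → ⟪x - q, d⟫_ℝ ≤ c).card : ℝ))
        + ((U.card : ℝ) - 12) / 2 * ((X \ P).card : ℝ)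
        + ∑ q ∈ X \ P,
          (((U.filter fun d => 0 < ⟪d, ν⟫_ℝ ∧ ∃ p ∈ P, dist q p = 1 ∧ c < ⟪p - q, d⟫_ℝ).card : ℝ)
            + (1 / 2) * ((U.filter fun d => ⟪d, ν⟫_ℝ = 0 ∧ ∃ p ∈ P, dist q p = 1 ∧ c < ⟪p - q, d⟫_ℝ).card : ℝ)) := by
  classical
  set cP : EuclideanSpace ℝ (Fin 3) → ℝ := fun q => ((P.filter fun p => dist q p = 1).card : ℝ) with hcP
  set dF : EuclideanSpace ℝ (Fin 3) → ℝ := fun q =>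
    (((X \ P).filter fun x => dist q x = 1).card : ℝ) with hdF
  set g : EuclideanSpace ℝ (Fin 3) → EuclideanSpace ℝ (Fin 3) → ℤ := fun x y =>
    (if ∃ d ∈ U, ⟪d, ν⟫_ℝ < 0 ∧ c < ⟪x - y, d⟫_ℝ then (1 : ℤ) else 0)
      + (if (∀ d ∈ U, ⟪x - y, d⟫_ℝ ≤ c) ∧ ⟪x, ν⟫_ℝ < ⟪y, ν⟫_ℝ then (1 : ℤ) else 0) with hg
  set t : EuclideanSpace ℝ (Fin 3) → EuclideanSpace ℝ (Fin 3) → ℤ := fun x y => g x y - g y x with ht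
  have ht_anti : ∀ x y, t x y = -t y x := fun x y => by simp only [ht]; ring
  set S : EuclideanSpace ℝ (Fin 3) → ℝ := fun q =>
    ((∑ x ∈ (X \ P).filter (fun x => dist q x = 1), t x q : ℤ) : ℝ) with hS
  set f : EuclideanSpace ℝ (Fin 3) → ℝ := fun q =>
    ((P.filter fun p => dist q p = 1 ∧ ∀ d ∈ U, ⟪p - q, d⟫_ℝ ≤ c).card : ℝ)
      + (((X \ P).filter fun x => dist q x = 1 ∧ (∀ d ∈ U, ⟪x - q, d⟫_ℝ ≤ c) ∧
          ⟪x, ν⟫_ℝ < ⟪q, ν⟫_ℝ).card : ℝ)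
      + (1 / 2) * (((X \ P).filter fun x => dist q x = 1 ∧ (∀ d ∈ U, ⟪x - q, d⟫_ℝ ≤ c) ∧
          ⟪x, ν⟫_ℝ = ⟪q, ν⟫_ℝ).card : ℝ)
      - ((U.filter fun d => ⟪d, ν⟫_ℝ < 0 ∧ ∀ x ∈ X, dist q x = 1 → ⟪x - q, d⟫_ℝ ≤ c).card : ℝ)
      - (1 / 2) * ((U.filter fun d => ⟪d, ν⟫_ℝ = 0 ∧ ∀ x ∈ X, dist q x = 1 → ⟪x - q, d⟫_ℝ ≤ c).card : ℝ)
    with hf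
  set r : EuclideanSpace ℝ (Fin 3) → ℝ := fun q =>
    ((U.filter fun d => 0 < ⟪d, ν⟫_ℝ ∧ ∃ p ∈ P, dist q p = 1 ∧ c < ⟪p - q, d⟫_ℝ).card : ℝ)
      + (1 / 2) * ((U.filter fun d => ⟪d, ν⟫_ℝ = 0 ∧ ∃ p ∈ P, dist q p = 1 ∧ c < ⟪p - q, d⟫_ℝ).card : ℝ)
    with hr
  -- per ball, exactly
  have hkey : ∀ q ∈ X \ P, 2 * cP q + dF q + S q = (U.card : ℝ) + 2 * f q + 2 * r q := by
    intro q hq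
    have hK := perBall_frameAccount_eq X P hX hPX U c hc3 hU1 hUsep hUneg ν q hq
    set T := ∑ x ∈ (X \ P).filter (fun x => dist q x = 1), t x q with hT
    have hK' := congrArg (fun z : ℤ => (z : ℝ)) hK
    simp only [hcP, hdF, hS, hf, hr, ← hT]
    push_cast at hK' ⊢
    linarith
  have hs0 : ∑ q ∈ X \ P, S q = 0 := by
    simp only [hS]
    rw [← Int.cast_sum, sum_sum_transfer_eq_zero (X \ P) t ht_anti, Int.cast_zero]
  have hcross : ((((P ×ˢ (X \ P)).filter fun pq => dist pq.1 pq.2 = 1).card : ℕ) : ℝ) =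
      ∑ q ∈ X \ P, cP q := card_cross_eq_sum_card_plug_partners P (X \ P)
  have hord : (orderedContacts (X \ P) : ℝ) = ∑ q ∈ X \ P, dF q :=
    orderedContacts_eq_sum_card_partners (X \ P)
  have hdef : contactDeficiency (X \ P) =
      6 * ((X \ P).card : ℝ) - (orderedContacts (X \ P) : ℝ) / 2 := rfl
  have hsum : ∑ q ∈ X \ P, (2 * cP q + dF q + S q) = ∑ q ∈ X \ P, ((U.card : ℝ) + 2 * f q + 2 * r q) :=
    sum_congr rfl hkey
  simp only [sum_add_distrib, sum_const, nsmul_eq_mul, ← mul_sum] at hsum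
  have hfsum : ∑ q ∈ X \ P, f q = ∑ q ∈ X \ P,
      (((P.filter fun p => dist q p = 1 ∧ ∀ d ∈ U, ⟪p - q, d⟫_ℝ ≤ c).card : ℝ)
        + (((X \ P).filter fun x => dist q x = 1 ∧ (∀ d ∈ U, ⟪x - q, d⟫_ℝ ≤ c) ∧
            ⟪x, ν⟫_ℝ < ⟪q, ν⟫_ℝ).card : ℝ)
        + (1 / 2) * (((X \ P).filter fun x => dist q x = 1 ∧ (∀ d ∈ U, ⟪x - q, d⟫_ℝ ≤ c) ∧
            ⟪x, ν⟫_ℝ = ⟪q, ν⟫_ℝ).card : ℝ)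
        - ((U.filter fun d => ⟪d, ν⟫_ℝ < 0 ∧ ∀ x ∈ X, dist q x = 1 → ⟪x - q, d⟫_ℝ ≤ c).card : ℝ)
        - (1 / 2) * ((U.filter fun d => ⟪d, ν⟫_ℝ = 0 ∧ ∀ x ∈ X, dist q x = 1 → ⟪x - q, d⟫_ℝ ≤ c).card : ℝ)) :=
    rfl
  have hrsum : ∑ q ∈ X \ P, r q = ∑ q ∈ X \ P,
      (((U.filter fun d => 0 < ⟪d, ν⟫_ℝ ∧ ∃ p ∈ P, dist q p = 1 ∧ c < ⟪p - q, d⟫_ℝ).card : ℝ)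
        + (1 / 2) * ((U.filter fun d => ⟪d, ν⟫_ℝ = 0 ∧ ∃ p ∈ P, dist q p = 1 ∧ c < ⟪p - q, d⟫_ℝ).card : ℝ)) :=
    rfl
  rw [← hfsum, ← hrsum, hcross, hdef, hord]
  linarith

end Summit.Ventures.Crystal3D.Theorems

end
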